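import Mathlib.Analysis.Calculus.MeanValue
import Mathlib.Analysis.Complex.Exponential
import Mathlib.MeasureTheory.Integral.IntervalIntegral.FundThmCalculus
import Literature.MathematicalPhysics.KineticTheory.InfiniteChainSuperstableEstimates
import HarnessLib

/-!
# The local energies `W_{μ,k}` along a solution of the infinite chain: flux and a priori bound

Topic `Literature/MathematicalPhysics/KineticTheory` (companion of `InfiniteChainSuperstableDynamics`,
`InfiniteChainSuperstableEstimates`). Pathwise (measure-free) calculus for Buttà–Marchioro's local
energies `W_{μ,k}` (P. Buttà, C. Marchioro, *Dynamics of infinite classical anharmonic crystals*,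
J. Stat. Phys. 164 (2016) 680–692, arXiv:1602.01294, §2 eq. (2.4)) along an ARBITRARY solution
`γ` of the equations of motion of the chain `P : OscillatorChain` (`OscillatorChain.IsSolution`),
for even polynomial `U`, `V`:

* `hasDerivAt_bmLocalEnergy_comp`: `t ↦ W_{μ,k}(γ t)` is differentiable, with derivative the
  "flux polynomial" `∑_{i ∈ Λ_{μ,k}} p_i (V'(q_{i+1} - q_i) - V'(q_i - q_{i-1}))
  + ∑_{i,j ∈ Λ_{μ,k}, |i-j|=1} V'(q_i - q_j)(p_i - p_j)` (the on-site terms `p_i U'(q_i)` cancel;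
  because (2.4) counts ORDERED pairs the interior bond terms do not telescope, which is irrelevant
  for the bound below);
* `abs_bmFlux_le`: the flux polynomial is bounded by `K · W_{μ,k+1}⁴` (crude: `|p_i| ≤ W`,
  `|V'(r)| ≤ 2 C₁ C₂ W` on the bonds of `Λ_{μ,k+1}` by the derivative bound and the coercivity of an
  even polynomial, `2k+1 ≤ W_{μ,k+1}`);
* `exp_bmLocalEnergy_comp_le`: the a priori bound behind the sup-in-time version of BM's (2.6):
  for `λ > 0`, `τ ≥ 0` and `t ∈ [0, τ]`,
  `exp(λ W_{μ,k}(γ t)) ≤ exp(λ W_{μ,k}(γ 0)) + (K/λ³) ∫₀^τ exp(2λ W_{μ,k+1}(γ s)) ds`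
  (fencing theorem `image_le_of_deriv_right_le_deriv_boundary` applied to `exp(λ W_{μ,k} ∘ γ)`,
  whose derivative is `≤ λ K W_{μ,k+1}⁴ e^{λ W_{μ,k+1}} ≤ (24K/λ³) e^{2λ W_{μ,k+1}}`).

These are the deterministic inputs of `InfiniteChainSuperstableOrbits` (a.e. orbit of a
measure-preserving dynamics of a superstable state stays in BM's good set `𝒳₀` at all times).
Standard energy-estimate calculus, not printed as such in BM 2016 (who work with the partial
dynamics); every declaration is tagged `[folklore]`. No definitions, no named facts.
-/

noncomputable section

open MeasureTheory Filter Set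
open scoped Topology BigOperators

namespace Literature.MathematicalPhysics.KineticTheory.HeatConduction

namespace OscillatorChain

variable {P : OscillatorChain}

/-! ### §1 The derivative of `W_{μ,k}` along a solution -/

/-- **Flux of the local energy along a solution.** For `U`, `V` differentiable and `γ` a solution
of the chain, `t ↦ W_{μ,k}(γ t)` has derivative
`∑_{i ∈ Λ} p_i (V'(q_{i+1}-q_i) - V'(q_i-q_{i-1})) + ∑_{i,j ∈ Λ, |j-i|=1} V'(q_i-q_j)(p_i-p_j)`
(evaluated at `γ t`, `Λ = Λ_{μ,k}`). [folklore] -/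
theorem hasDerivAt_bmLocalEnergy_comp (hU : Differentiable ℝ P.U) (hV : Differentiable ℝ P.V)
    {γ : ℝ → ChainConfig} (hγ : P.IsSolution γ) (μ : ℤ) (k : ℕ) (t : ℝ) :
    HasDerivAt (fun s => P.bmLocalEnergy μ k (γ s))
      ((∑ i ∈ Finset.Icc (μ - k) (μ + k), (γ t i).2 *
          (deriv P.V ((γ t (i + 1)).1 - (γ t i).1) - deriv P.V ((γ t i).1 - (γ t (i - 1)).1))) +
        ∑ i ∈ Finset.Icc (μ - k) (μ + k), ∑ j ∈ Finset.Icc (μ - k) (μ + k),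
          if |j - i| = 1 then deriv P.V ((γ t i).1 - (γ t j).1) * ((γ t i).2 - (γ t j).2)
          else 0) t := by
  have hq : ∀ i, HasDerivAt (fun s => (γ s i).1) (γ t i).2 t := fun i => (hγ i t).1
  have hp : ∀ i, HasDerivAt (fun s => (γ s i).2) (P.force (γ t) i) t := fun i => (hγ i t).2
  unfold bmLocalEnergy
  refine (HasDerivAt.fun_sum fun i _ => ?_).add
    (HasDerivAt.fun_sum fun i _ => HasDerivAt.fun_sum fun j _ => ?_)
  · have h1 := ((hp i).fun_pow 2).div_const 2
    have h2 := (hU _).hasDerivAt.comp t (hq i)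
    refine ((h1.add h2).add_const 1).congr_deriv ?_
    simp only [Nat.cast_ofNat, Nat.add_one_sub_one, pow_one, force_eq]
    ring
  · by_cases h : |j - i| = 1
    · simp only [if_pos h]
      exact (hV _).hasDerivAt.comp t ((hq i).sub (hq j))
    · simp only [if_neg h]
      exact hasDerivAt_const t 0

/-- Along a solution each `t ↦ W_{μ,k}(γ t)` is continuous (cf. `continuous_bmLocalEnergy_comp` in
`InfiniteChainSuperstableDynamicsProofs`, stated for continuous curves). [folklore] -/
theorem continuous_bmLocalEnergy_comp_of_isSolution (hU : Differentiable ℝ P.U) (hV : Differentiable ℝ P.V)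
    {γ : ℝ → ChainConfig} (hγ : P.IsSolution γ) (μ : ℤ) (k : ℕ) :
    Continuous fun s => P.bmLocalEnergy μ k (γ s) :=
  continuous_iff_continuousAt.2 fun t =>
    (hasDerivAt_bmLocalEnergy_comp hU hV hγ μ k t).continuousAt

/-! ### §2 The flux is dominated by a power of the next local energy -/

/-- `|p| ≤ W_{μ,k}(σ)` for every momentum of a site of `Λ_{μ,k}` (`U, V ≥ 0`). [folklore] -/
theorem abs_snd_le_bmLocalEnergy (hU0 : ∀ r, 0 ≤ P.U r) (hV0 : ∀ r, 0 ≤ P.V r) {μ : ℤ} {k : ℕ}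
    (σ : ChainConfig) {i : ℤ} (hi : i ∈ Finset.Icc (μ - k) (μ + k)) :
    |(σ i).2| ≤ P.bmLocalEnergy μ k σ := by
  have h := site_le_bmLocalEnergy hU0 hV0 σ hi
  have hU := hU0 (σ i).1
  nlinarith [sq_abs (σ i).2, sq_nonneg (|(σ i).2| - 1), abs_nonneg (σ i).2]

/-- **The flux bound.** For `U ≥ 0` and `V` an even non-negative polynomial of degree `2s₂ ≥ 2`
there is `K ≥ 0` with
`|∑_{i∈Λ_{μ,k}} p_i (V'(q_{i+1}-q_i) - V'(q_i-q_{i-1})) + ∑_{i,j∈Λ_{μ,k},|j-i|=1} V'(q_i-q_j)(p_i-p_j)|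
  ≤ K W_{μ,k+1}(σ)⁴` for all `μ`, `k`, `σ`. [folklore] -/
theorem abs_bmFlux_le {s₂ : ℕ} (h₂ : 1 ≤ s₂) (hU0 : ∀ r, 0 ≤ P.U r)
    (hV : IsEvenPolyOfDegree P.V s₂) :
    ∃ K : ℝ, 0 ≤ K ∧ ∀ (μ : ℤ) (k : ℕ) (σ : ChainConfig),
      |(∑ i ∈ Finset.Icc (μ - k) (μ + k), (σ i).2 *
          (deriv P.V ((σ (i + 1)).1 - (σ i).1) - deriv P.V ((σ i).1 - (σ (i - 1)).1))) +
        ∑ i ∈ Finset.Icc (μ - k) (μ + k), ∑ j ∈ Finset.Icc (μ - k) (μ + k),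
          if |j - i| = 1 then deriv P.V ((σ i).1 - (σ j).1) * ((σ i).2 - (σ j).2) else 0| ≤
      K * P.bmLocalEnergy μ (k + 1) σ ^ 4 := by
  obtain ⟨C₁, hC₁, hV', -⟩ := hV.exists_deriv_bound
  obtain ⟨C₂, hC₂, hcoer⟩ := hV.exists_one_add_abs_pow_le h₂
  have hV0 : ∀ r, 0 ≤ P.V r := hV.choose_spec.2.2
  have hVe : ∀ r, P.V (-r) = P.V r := fun r => congrFun hV.comp_neg r
  refine ⟨8 * C₁ * C₂, by positivity, fun μ k σ => ?_⟩
  set Λ := Finset.Icc (μ - k) (μ + k) with hΛ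
  set Λ' := Finset.Icc (μ - ↑(k + 1)) (μ + ↑(k + 1)) with hΛ'
  set W := P.bmLocalEnergy μ (k + 1) σ with hW
  have hW1 : 1 ≤ W := one_le_bmLocalEnergy hU0 hV0 μ (k + 1) σ
  have hWk : 2 * (k : ℝ) + 3 ≤ W := by
    have := card_le_bmLocalEnergy hU0 hV0 μ (k + 1) σ
    push_cast at this
    linarith
  have hsub : Λ ⊆ Λ' := cbox_subset (Nat.le_succ k)
  have hmem : ∀ i ∈ Λ, i ∈ Λ' ∧ i + 1 ∈ Λ' ∧ i - 1 ∈ Λ' := by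
    intro i hi
    rw [hΛ, Finset.mem_Icc] at hi
    simp only [hΛ', Finset.mem_Icc]
    push_cast
    omega
  -- derivative bound on a bond of `Λ'`, in both orientations
  have hb : ∀ x : ℝ, P.V x ≤ W →
      |deriv P.V x| ≤ 2 * C₁ * C₂ * W ∧ |deriv P.V (-x)| ≤ 2 * C₁ * C₂ * W := by
    intro x hx
    have h1 : (1 + |x|) ^ (2 * s₂ - 1) ≤ (1 + |x|) ^ (2 * s₂) :=
      pow_le_pow_right₀ (by linarith [abs_nonneg x]) (Nat.sub_le _ _)
    have h2 : (1 + |x|) ^ (2 * s₂) ≤ 2 * C₂ * W := by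
      calc (1 + |x|) ^ (2 * s₂) ≤ C₂ * (P.V x + 1) := hcoer x
        _ ≤ C₂ * (2 * W) := by
            refine mul_le_mul_of_nonneg_left ?_ (by linarith)
            linarith
        _ = 2 * C₂ * W := by ring
    refine ⟨?_, ?_⟩
    · calc |deriv P.V x| ≤ C₁ * (1 + |x|) ^ (2 * s₂ - 1) := hV' x
        _ ≤ C₁ * (2 * C₂ * W) := mul_le_mul_of_nonneg_left (h1.trans h2) hC₁
        _ = 2 * C₁ * C₂ * W := by ring
    · calc |deriv P.V (-x)| ≤ C₁ * (1 + |-x|) ^ (2 * s₂ - 1) := hV' (-x)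
        _ = C₁ * (1 + |x|) ^ (2 * s₂ - 1) := by rw [abs_neg]
        _ ≤ C₁ * (2 * C₂ * W) := mul_le_mul_of_nonneg_left (h1.trans h2) hC₁
        _ = 2 * C₁ * C₂ * W := by ring
  -- bonds and momenta of `Λ'`
  have hbond : ∀ i, i ∈ Λ' → i - 1 ∈ Λ' → P.V ((σ i).1 - (σ (i - 1)).1) ≤ W :=
    fun i hi hi' => bond_le_bmLocalEnergy hU0 hV0 σ hi hi'
  have hbond' : ∀ i, i ∈ Λ' → i + 1 ∈ Λ' → P.V ((σ (i + 1)).1 - (σ i).1) ≤ W := by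
    intro i hi hi'
    have h := hbond (i + 1) hi' (by simpa using hi)
    simpa using h
  have hmom : ∀ i ∈ Λ', |(σ i).2| ≤ W := fun i hi => abs_snd_le_bmLocalEnergy hU0 hV0 σ hi
  have hK0 : 0 ≤ 2 * C₁ * C₂ * W := by positivity
  -- the site part
  have hsite : |∑ i ∈ Λ, (σ i).2 *
      (deriv P.V ((σ (i + 1)).1 - (σ i).1) - deriv P.V ((σ i).1 - (σ (i - 1)).1))| ≤
      4 * C₁ * C₂ * W ^ 4 := by
    calc |∑ i ∈ Λ, (σ i).2 *
          (deriv P.V ((σ (i + 1)).1 - (σ i).1) - deriv P.V ((σ i).1 - (σ (i - 1)).1))|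
        ≤ ∑ i ∈ Λ, |(σ i).2 *
          (deriv P.V ((σ (i + 1)).1 - (σ i).1) - deriv P.V ((σ i).1 - (σ (i - 1)).1))| :=
          Finset.abs_sum_le_sum_abs _ _
      _ ≤ ∑ i ∈ Λ, W * (4 * C₁ * C₂ * W) := by
          refine Finset.sum_le_sum fun i hi => ?_
          obtain ⟨h0, hp1, hm1⟩ := hmem i hi
          rw [abs_mul]
          refine mul_le_mul (hmom i h0) ?_ (abs_nonneg _) (by positivity)
          have ha := (hb _ (hbond' i h0 hp1)).1
          have hb' := (hb _ (hbond i h0 hm1)).1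
          calc |deriv P.V ((σ (i + 1)).1 - (σ i).1) - deriv P.V ((σ i).1 - (σ (i - 1)).1)|
              ≤ |deriv P.V ((σ (i + 1)).1 - (σ i).1)| + |deriv P.V ((σ i).1 - (σ (i - 1)).1)| :=
                abs_sub _ _
            _ ≤ 2 * C₁ * C₂ * W + 2 * C₁ * C₂ * W := add_le_add ha hb'
            _ = 4 * C₁ * C₂ * W := by ring
      _ = (2 * (k : ℝ) + 1) * (W * (4 * C₁ * C₂ * W)) := by
          rw [Finset.sum_const, card_cbox, nsmul_eq_mul]
          push_cast
          ring
      _ ≤ W * (W * (4 * C₁ * C₂ * W)) := by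
          refine mul_le_mul_of_nonneg_right (by linarith) (by positivity)
      _ = 4 * C₁ * C₂ * W ^ 3 := by ring
      _ ≤ 4 * C₁ * C₂ * W ^ 4 := by
          refine mul_le_mul_of_nonneg_left ?_ (by positivity)
          exact pow_le_pow_right₀ hW1 (by norm_num)
  -- the pair part
  have hpair : |∑ i ∈ Λ, ∑ j ∈ Λ,
      (if |j - i| = 1 then deriv P.V ((σ i).1 - (σ j).1) * ((σ i).2 - (σ j).2) else 0)| ≤
      4 * C₁ * C₂ * W ^ 4 := by
    have hterm : ∀ i ∈ Λ, ∀ j ∈ Λ,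
        |(if |j - i| = 1 then deriv P.V ((σ i).1 - (σ j).1) * ((σ i).2 - (σ j).2) else 0)| ≤
          4 * C₁ * C₂ * W ^ 2 := by
      intro i hi j hj
      obtain ⟨hi0, hip, him⟩ := hmem i hi
      obtain ⟨hj0, -, -⟩ := hmem j hj
      split_ifs with hij
      · have hpp : |(σ i).2 - (σ j).2| ≤ 2 * W :=
          (abs_sub _ _).trans (by linarith [hmom i hi0, hmom j hj0])
        have hd : |deriv P.V ((σ i).1 - (σ j).1)| ≤ 2 * C₁ * C₂ * W := by
          have hj' : j = i - 1 ∨ j = i + 1 := by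
            rcases abs_eq (zero_le_one' ℤ) |>.1 hij with h | h <;> omega
          rcases hj' with rfl | rfl
          · exact (hb _ (hbond i hi0 him)).1
          · have h := (hb _ (hbond' i hi0 hip)).2
            rwa [neg_sub] at h
        rw [abs_mul]
        calc |deriv P.V ((σ i).1 - (σ j).1)| * |(σ i).2 - (σ j).2|
            ≤ 2 * C₁ * C₂ * W * (2 * W) := mul_le_mul hd hpp (abs_nonneg _) hK0
          _ = 4 * C₁ * C₂ * W ^ 2 := by ring
      · rw [abs_zero]
        positivity
    calc |∑ i ∈ Λ, ∑ j ∈ Λ,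
          (if |j - i| = 1 then deriv P.V ((σ i).1 - (σ j).1) * ((σ i).2 - (σ j).2) else 0)|
        ≤ ∑ i ∈ Λ, |∑ j ∈ Λ,
          (if |j - i| = 1 then deriv P.V ((σ i).1 - (σ j).1) * ((σ i).2 - (σ j).2) else 0)| :=
          Finset.abs_sum_le_sum_abs _ _
      _ ≤ ∑ i ∈ Λ, ∑ j ∈ Λ,
          |(if |j - i| = 1 then deriv P.V ((σ i).1 - (σ j).1) * ((σ i).2 - (σ j).2) else 0)| :=
          Finset.sum_le_sum fun i _ => Finset.abs_sum_le_sum_abs _ _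
      _ ≤ ∑ i ∈ Λ, ∑ j ∈ Λ, 4 * C₁ * C₂ * W ^ 2 :=
          Finset.sum_le_sum fun i hi => Finset.sum_le_sum fun j hj => hterm i hi j hj
      _ = (2 * (k : ℝ) + 1) ^ 2 * (4 * C₁ * C₂ * W ^ 2) := by
          rw [Finset.sum_const, Finset.sum_const, card_cbox, nsmul_eq_mul, nsmul_eq_mul]
          push_cast
          ring
      _ ≤ W ^ 2 * (4 * C₁ * C₂ * W ^ 2) := by
          refine mul_le_mul_of_nonneg_right ?_ (by positivity)
          exact pow_le_pow_left₀ (by positivity) (by linarith) 2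
      _ = 4 * C₁ * C₂ * W ^ 4 := by ring
  calc _ ≤ |∑ i ∈ Λ, (σ i).2 *
          (deriv P.V ((σ (i + 1)).1 - (σ i).1) - deriv P.V ((σ i).1 - (σ (i - 1)).1))| +
        |∑ i ∈ Λ, ∑ j ∈ Λ,
          (if |j - i| = 1 then deriv P.V ((σ i).1 - (σ j).1) * ((σ i).2 - (σ j).2) else 0)| :=
        abs_add_le _ _
    _ ≤ 4 * C₁ * C₂ * W ^ 4 + 4 * C₁ * C₂ * W ^ 4 := add_le_add hsite hpair
    _ = 8 * C₁ * C₂ * P.bmLocalEnergy μ (k + 1) σ ^ 4 := by rw [hW]; ring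

/-! ### §3 The a priori bound for `exp(λ W_{μ,k})` along a solution -/

/-- `w⁴ ≤ 24 e^{λ w} / λ⁴` for `w ≥ 0`, `λ > 0` (from `x⁴/4! ≤ eˣ`). [folklore] -/
theorem pow_four_le_exp_mul {lam w : ℝ} (hlam : 0 < lam) (hw : 0 ≤ w) :
    w ^ 4 ≤ 24 / lam ^ 4 * Real.exp (lam * w) := by
  have h := Real.pow_div_factorial_le_exp (lam * w) (mul_nonneg hlam.le hw) 4
  have h4 : ((4 : ℕ).factorial : ℝ) = 24 := by norm_num [Nat.factorial]
  rw [h4, div_le_iff₀ (by norm_num : (0 : ℝ) < 24), mul_pow] at h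
  have hl4 : 0 < lam ^ 4 := pow_pos hlam 4
  rw [div_mul_eq_mul_div, le_div_iff₀ hl4]
  linarith

/-- **A priori bound for the exponential local energy along a solution.** For `U`, `V` even
non-negative polynomials (`deg V = 2s₂ ≥ 2`) there is `K ≥ 0` such that for every solution `γ`
of the chain, all `μ`, `k`, all `λ > 0`, `τ ≥ 0` and `t ∈ [0, τ]`,
`exp(λ W_{μ,k}(γ t)) ≤ exp(λ W_{μ,k}(γ 0)) + (K/λ³) ∫₀^τ exp(2λ W_{μ,k+1}(γ s)) ds`
(the derivative of `exp(λ W_{μ,k} ∘ γ)` is at most `λ · (flux) · e^{λ W_{μ,k}} ≤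
(K/λ³) e^{2λ W_{μ,k+1}}` by `abs_bmFlux_le`, `W_{μ,k} ≤ W_{μ,k+1}` and `w⁴ ≤ 24 e^{λw}/λ⁴`; then
the fencing theorem). [folklore] -/
theorem exp_bmLocalEnergy_comp_le {s₁ s₂ : ℕ} (h₂ : 1 ≤ s₂) (hU : IsEvenPolyOfDegree P.U s₁)
    (hV : IsEvenPolyOfDegree P.V s₂) :
    ∃ K : ℝ, 0 ≤ K ∧ ∀ (γ : ℝ → ChainConfig), P.IsSolution γ →
      ∀ (μ : ℤ) (k : ℕ) (lam τ : ℝ), 0 < lam → 0 ≤ τ → ∀ t ∈ Icc (0 : ℝ) τ,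
        Real.exp (lam * P.bmLocalEnergy μ k (γ t)) ≤ Real.exp (lam * P.bmLocalEnergy μ k (γ 0)) +
          K / lam ^ 3 * ∫ s in (0 : ℝ)..τ, Real.exp (2 * lam * P.bmLocalEnergy μ (k + 1) (γ s)) := by
  have hU0 : ∀ r, 0 ≤ P.U r := hU.choose_spec.2.2
  have hV0 : ∀ r, 0 ≤ P.V r := hV.choose_spec.2.2
  obtain ⟨K₀, hK₀, hflux⟩ := abs_bmFlux_le h₂ hU0 hV
  refine ⟨24 * K₀, by positivity, ?_⟩
  intro γ hγ μ k lam τ hlam hτ t ht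
  have hUd : Differentiable ℝ P.U := hU.contDiff_two.differentiable (by simp)
  have hVd : Differentiable ℝ P.V := hV.contDiff_two.differentiable (by simp)
  -- the two functions of time and their derivatives
  set W : ℕ → ℝ → ℝ := fun k s => P.bmLocalEnergy μ k (γ s) with hW
  set G : ℝ → ℝ := fun s =>
    (∑ i ∈ Finset.Icc (μ - k) (μ + k), (γ s i).2 *
        (deriv P.V ((γ s (i + 1)).1 - (γ s i).1) - deriv P.V ((γ s i).1 - (γ s (i - 1)).1))) +
      ∑ i ∈ Finset.Icc (μ - k) (μ + k), ∑ j ∈ Finset.Icc (μ - k) (μ + k),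
        if |j - i| = 1 then deriv P.V ((γ s i).1 - (γ s j).1) * ((γ s i).2 - (γ s j).2)
        else 0 with hG
  set f : ℝ → ℝ := fun s => Real.exp (lam * W k s) with hf
  set g : ℝ → ℝ := fun s => Real.exp (2 * lam * W (k + 1) s) with hg
  have hWd : ∀ s, HasDerivAt (W k) (G s) s := fun s =>
    hasDerivAt_bmLocalEnergy_comp hUd hVd hγ μ k s
  have hf' : ∀ s, HasDerivAt f (Real.exp (lam * W k s) * (lam * G s)) s := fun s =>
    ((hWd s).const_mul lam).exp
  have hgc : Continuous g :=
    Real.continuous_exp.comp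
      (continuous_const.mul (continuous_bmLocalEnergy_comp_of_isSolution hUd hVd hγ μ (k + 1)))
  have hfc : Continuous f := continuous_iff_continuousAt.2 fun s => (hf' s).continuousAt
  -- the comparison function `B(u) = f(0) + (24 K₀/λ³) ∫₀ᵘ g`
  set c : ℝ := 24 * K₀ / lam ^ 3 with hc
  have hc0 : 0 ≤ c := by positivity
  set B : ℝ → ℝ := fun u => f 0 + c * ∫ s in (0 : ℝ)..u, g s with hB
  have hB' : ∀ u, HasDerivAt B (c * g u) u := fun u =>
    ((hgc.integral_hasStrictDerivAt 0 u).hasDerivAt.const_mul c).const_add (f 0)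
  have hBc : Continuous B := continuous_iff_continuousAt.2 fun u => (hB' u).continuousAt
  -- the derivative bound `f' ≤ B'`
  have hbound : ∀ s, Real.exp (lam * W k s) * (lam * G s) ≤ c * g s := by
    intro s
    have hW1 : 1 ≤ W (k + 1) s := one_le_bmLocalEnergy hU0 hV0 μ (k + 1) (γ s)
    have hmono : W k s ≤ W (k + 1) s := bmLocalEnergy_mono hU0 hV0 μ (Nat.le_succ k) (γ s)
    have hGs : |G s| ≤ K₀ * W (k + 1) s ^ 4 := hflux μ k (γ s)
    have h4 : W (k + 1) s ^ 4 ≤ 24 / lam ^ 4 * Real.exp (lam * W (k + 1) s) :=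
      pow_four_le_exp_mul hlam (by linarith)
    have he : Real.exp (lam * W k s) ≤ Real.exp (lam * W (k + 1) s) :=
      Real.exp_le_exp.2 (mul_le_mul_of_nonneg_left hmono hlam.le)
    have hsq : Real.exp (lam * W (k + 1) s) * Real.exp (lam * W (k + 1) s) = g s := by
      rw [hg, ← Real.exp_add]
      ring_nf
    calc Real.exp (lam * W k s) * (lam * G s)
        ≤ Real.exp (lam * W k s) * (lam * |G s|) := by
          gcongr
          exact le_abs_self _
      _ ≤ Real.exp (lam * W (k + 1) s) * (lam * (K₀ * W (k + 1) s ^ 4)) := by gcongr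
      _ ≤ Real.exp (lam * W (k + 1) s) *
            (lam * (K₀ * (24 / lam ^ 4 * Real.exp (lam * W (k + 1) s)))) := by gcongr
      _ = c * (Real.exp (lam * W (k + 1) s) * Real.exp (lam * W (k + 1) s)) := by
          rw [hc]
          field_simp
      _ = c * g s := by rw [hsq]
  -- fencing
  have key := image_le_of_deriv_right_le_deriv_boundary (f := f)
    (f' := fun s => Real.exp (lam * W k s) * (lam * G s)) (a := 0) (b := τ) hfc.continuousOn
    (fun s _ => (hf' s).hasDerivWithinAt) (B := B) (B' := fun u => c * g u)
    (by simp [hB]) hBc.continuousOn (fun u _ => (hB' u).hasDerivWithinAt)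
    (fun s _ => hbound s) ht
  -- `∫₀ᵗ g ≤ ∫₀^τ g`
  have hmono : ∫ s in (0 : ℝ)..t, g s ≤ ∫ s in (0 : ℝ)..τ, g s :=
    intervalIntegral.integral_mono_interval le_rfl ht.1 ht.2
      (Eventually.of_forall fun s => (Real.exp_pos _).le) (hgc.intervalIntegrable 0 τ)
  calc f t ≤ B t := key
    _ ≤ f 0 + c * ∫ s in (0 : ℝ)..τ, g s := by
        simp only [hB]
        gcongr
    _ = _ := rfl

end OscillatorChain

end Literature.MathematicalPhysics.KineticTheory.HeatConduction
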